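import Summits.QuantumFields.BalabanUV.Beta.CombRemainderTadpoleSlotScaled
import Summits.QuantumFields.BalabanUV.Beta.CombLevelZeroT2LawScaled
import Summits.QuantumFields.BalabanUV.Beta.CombChartJointEndReflTablesAn1S2NScaled
import Summits.QuantumFields.BalabanUV.Beta.CombRemainderParityAll

/-!
# `BalabanUV.Beta.CombRemainderParityAllScaled` — binder row D1, the (III″) κ-TWIN CHAIN (an2 W-3 l.63100 (D6)'s named target; programme P5, bricks P5-b∕c-κ):
# **THE κ-GENERIC ROOT — `D1Drift (JsB12CombShSym hLc N (symTablesAn1S2w 3 Lc (w·cΛ) w) (w·cΛ) cB) ⟸ hΛ ∧ hcB ∧ D1Tel ∧ D1Rep` FOR EVERY GROUP WEIGHT `w`**,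
# the row parities of leaf-03's `combR2An1W`∕`combΔAn1W` at every level, and the κ-literal's scalar `hRm0` DISCHARGED

WHY (an2 RULING R-D1-g56-4 (4-2), SPEC (III″) v1.2 `gen56/III2-SPEC-g56.v1_2.md` db3f1dcee2ceae52 §5, W-3 l.63100 (S)∕(D6) «the (III″) ROOT = the κ-GENERIC twin
of the root of record … plus a one-line DISPLAY corollary at κ = Lc¹²∕4», W-5 + CORRECTION C-an2-g56-2 l.63171, RCPT-4∕R5 l.63155 + leaf-01 R-2 l.63194 (the member
w = Lc¹²∕4 ACCEPTED BY VALUE at level 0: Engine C `prestab/atk/ATK.md` ea54d781657b45d1 — two programs, three planes, two torus sizes, every word); leaf-04 g33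
(S2w … Nw chain), leaf-03 g50 (P1–P4), an2 INTENT-5 `SymLamGroupScaling`): ROOT M‴ `CombRemainderParityAll.d1Drift_JsB12CombShSym_an1TablesS2_pinned_of_locks_D1Tel_D1Rep`
is the member w = 1 of a ONE-PARAMETER FAMILY of conditional theorems — the (III″) literal carries M‴'s Λ group (mixed table, multiplier ∕ first-order Λ
pin, mixed remainders) at the group weight `w` with the BASE lock `cΛ·Lc⁴ = 2` verbatim — and EVERY letter of M‴'s chain is either pin-generic or Λ-linear,
so the whole chain re-runs for every real `w` (leaf-04's S2w→Nw over an2's∕leaf-04's scaled letters; leaf-03's slotted remainder objects and their classes;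
this lineage's P5).  THIS FILE is the κ-twin of an2 gen 39's `CombRemainderParityAll`: §1 the row parity of the split defect from that of the T2-remainder
(the parent's §3 first lemma re-run summand by summand over leaf-03's `combΔOfAtW_eq_sharp`: contact mismatch and contact-kernel vertex = the parent's words
at the pin `w·cΛ`; slots = leaf-05's `trK_vertex2OfK_of_rows` ∕ `trK_mixOfK_of_rows` with `parityOdd_smul w (trK_symRMrAn1 …)`), the row parity of
`combR2An1W` at EVERY level by the parent's induction (base `CombLevelZeroT2LawScaled.combR2An1W_zero_eq_zero`; step leaf-03's `hR2succ_combW` — the four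
sandwich-defect words vanish by the parent's §1 BY NAME, κ-free), §2 `hR2tadW_all` and **`hRm0W_discharged`** (P5-a-κ `CombRemainderTadpoleSlotScaled.hRm0W_of_hR2tad`),
§3 **THE κ-GENERIC ROOT** = leaf-04's Nw root `CombChartJointEndReflTablesAn1S2NScaled.…_pinned_of_locks_hcomp_D1Tel_D1Rep` with its scalar SUPPLIED by §2 —
EXACTLY as M‴ applies N.  [folklore] kernel algebra BY NAME; nothing of an1's ∕ an2's ∕ an3's ∕ leaf-03's ∕ leaf-04's ∕ leaf-05's restated.
WHAT IS LEFT DISPLAYED in the root (VERBATIM M‴'s): the two unit locks (`hΛ`, `hcB`), the telescoping binder `D1Tel` (road FP) and the representation binder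
`D1Rep` (road BF-x) of THIS literal, the printed B5 facts `h12`∕`h126`, the window, `μ ≠ ν`, `Nc ≠ 0`, `Odd Lc`, `2 ≤ Lc`, `2 ≤ N`; binder census vs M‴ = +1
group `(cΛ w cB : ℝ)`, every other binder identical (record and pin re-instantiated at `(w·cΛ, w)`).  NO VALUE of `w` here — the (III″) DISPLAY `w = Lc¹²∕4`
is `D1LiteralLagrangianRoot`'s one-line corollary.  At `w = 1` the root IS M‴'s statement (`SymTablesAn1S2Weighted.symTablesAn1S2w_one`, `one_mul`).
WHAT THIS IS NOT: not D1 (`D1Tel`, `D1Rep` are hypotheses — the roads'); 0∕4 row-D1 binders discharged by it beyond what M‴ already had for w = 1 (hW∕hR of THIS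
family = table letters + this chain, as for M‴); nothing of Bałaban's asserted, valued or discharged; ROOT M‴ p325680 and the root of record untouched (new files
only); (J1) ONE OPEN ROW — dormant by value; (K) NOT closed; NEVER «G-an2-4 closed», NOT BetaPertH, NOT continuum, NOT Clay.

HONEST DEPENDENCY (page 1, mandatory): continuum YM on T⁴ ⇐ BetaPertH ∧ nine spine estimates (0/9 proved); BetaPertH ⇐ (D1) ∧ (D4) ∧ CAP+tail;
G-an2-4 gates asym, D1 and NE2/3/4.  DERIVED cell leaf ([folklore] BY NAME; β sub-cell, D1 formalisation swarm leaf prover 01 (`b2b-balaban-beta-d1-formalise-leaf-01`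
gen 42), 2026-08-25 (v1); INTENT I-leaf01-g42-1 «P5-κ» l.63217); over an2 gen 39's `CombRemainderParityAll` (§1∕§2 BY NAME), this lineage's
`CombRemainderTadpoleSlotScaled` ∕ `CombLevelZeroT2LawScaled`, leaf-03 g50's `CombSecondOrderRemainderAn1Scaled` ∕ `CombSecondOrderDeltaSepScaled`, leaf-04 g33's
`CombChartJointEndReflTablesAn1S2NScaled` and `SymTablesAn1S2Weighted`; no statement of Bałaban's papers, no `[cite:]`, no `Prop` fact, no `def`; no existing file touched.
-/

noncomputable section

open Finset
open scoped BigOperators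
open Literature.MathematicalPhysics.QuantumFieldTheory
open Literature.MathematicalPhysics.QuantumFieldTheory.Balaban1983to89
open Literature.MathematicalPhysics.QuantumFieldTheory.Balaban1983to89.Beta
open ExpKernelCalculus (MKer Decays BiLoc comp tadpole)
open PolarizationSign (reflSign)
open AveragingContoursRooted (ctr ctrOff ctrOff_mem_box)
open OneStepResolventKernel (Fib LocStencil decays_mono)
open OneStepKernelFamily (colH vertexOfK)
open BalabanStepJetsSucc (wVH mmRead)
open BalabanStepW2 (wM1 wM2 wV4 M2Of)
open BalabanCompositeJets (LocStencil₂)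
open SecondOrderResponse (dM K2OfK vertex2OfK mixOfK)
open WilsonVertex2Sym (wsym22)
open StepDriftWitness (comp_zero_right)
open Summit.QuantumFields.BalabanUV.Beta.TameKernelCalculus
open Summit.QuantumFields.BalabanUV.Beta.ChartConjugation (conjV conjW loc_conjV)
open Summit.QuantumFields.BalabanUV.Beta.ChartConjugationDefectEnd (sandwichDefect)
open Summit.QuantumFields.BalabanUV.Beta.ChartConjugationRelative (RelInv rule_left_rel rule_right_rel spr_comp)
open Summit.QuantumFields.BalabanUV.Beta.KernelWardRelative (conjV_zero comp_zero_left)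
open Summit.QuantumFields.BalabanUV.Beta.KernelWardRemainderParity (parityOdd_add)
open Summit.QuantumFields.BalabanUV.Beta.AxialDressingRooted (one_le_of_neZero axEc spr_axEc)
open Summit.QuantumFields.BalabanUV.Beta.SymShiftedSpread (bhKStepSh bhKStepSh_zero spr_bhKStepSh)
open Summit.QuantumFields.BalabanUV.Beta.BorderedHessian (sgnK sgnK_apply sgnF sgnF_inl sgnF_inr bhK trK_bhK stepScale diagK comp_axEc_diagK_comm)
open Summit.QuantumFields.BalabanUV.Beta.E3ContactGenerator (ctGenM)
open Summit.QuantumFields.BalabanUV.Beta.DshAn1 (Dsh spr_Dsh Dsh_inr_inl_eq_neg Dsh_inl_inl Dsh_inr_inr)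
open Summit.QuantumFields.BalabanUV.Beta.SymAveragingHessianCounts (symVhSAt symHessFFAt)
open Summit.QuantumFields.BalabanUV.Beta.SymAveragingMixedJetTables (symMixFFAt)
open Summit.QuantumFields.BalabanUV.Beta.SymSecondOrderTablesAn1 (symVh₂SAn1)
open Summit.QuantumFields.BalabanUV.Beta.SymMixedReflectionLetterAn1 (symRMrAn1)
open Summit.QuantumFields.BalabanUV.Beta.SpineRecursiveParity (parityOdd_smul parityOdd_zero parityOdd_dM)
open Summit.QuantumFields.BalabanUV.Beta.SymTablesAn1FirstOrder (trK_symVhSAt trK_symHessFFAt trK_M1Of_symHessFFAt)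
open Summit.QuantumFields.BalabanUV.Beta.SymmetrisedStepJetsParity (trK_SpureRecOf)
open Summit.QuantumFields.BalabanUV.Beta.SymAveragingHessianCounts (symVhSAt_hV_ctr symHessFFAt_hH_ctr)
open Summit.QuantumFields.BalabanUV.Beta.SecondOrderRemainderTables (trK_vertex2OfK_of_rows trK_mixOfK_of_rows tadpole_vertex2OfK_eq_zero)
open Summit.QuantumFields.BalabanUV.Beta.SecondOrderStepRemainder (parityOdd_conjV_diagK_of_even parityOdd_conjV_mmRead_diagK parityOdd_mmRead_sandwich)
open Summit.QuantumFields.BalabanUV.Beta.CombChartStepJets (GcombSh decays_GcombSh)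
open Summit.QuantumFields.BalabanUV.Beta.CombChartWardSockets (trK_GcombSh)
open Summit.QuantumFields.BalabanUV.Beta.CombChartContactFactor (spr_GcombSh)
open Summit.QuantumFields.BalabanUV.Beta.CombChartSpreadBlind (trK_bhKStepSh_succ)
open Summit.QuantumFields.BalabanUV.Beta.RelInvCombShiftedSpread (relInv_coDressKAt_Gsym_bhKStepSh)
open Summit.QuantumFields.BalabanUV.Beta.SpineRooted (M1Of SpureRecOf T2RecOf)
open Summit.QuantumFields.BalabanUV.Beta.CombSecondOrderRemainderAn1 (combΔOfAt combR2An1 combΔAn1 hR2succ_comb)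
open Summit.QuantumFields.BalabanUV.Beta.CombSecondOrderDeltaSep (comb_letters_common combΔOfAt_eq_sharp locStencil₂_combR2An1 hΔL_pinned)
open Summit.QuantumFields.BalabanUV.Beta.SecondOrderSplitLoc (loc_diagK_dressed)
open Summit.QuantumFields.BalabanUV.Beta.SpineRecursiveParity (parityOdd_neg)
open Summit.QuantumFields.BalabanUV.Beta.SymSecondOrderDeltaSep (sep_zeroTable)
open Summit.QuantumFields.BalabanUV.Beta.CombRemainderTadpoleSlot (trK_symRMrAn1 conjW_sub_conjW diagK_zeroTable diagK_zeroTable_sub lock_of_hΛ hRm0_of_hR2tad)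
open Summit.QuantumFields.BalabanUV.Beta.CombChartJointEnd (JsB12CombShSym)
open Summit.QuantumFields.BalabanUV.Beta.SymSecondOrderTablesAn1 (symTablesAn1S2)
open Summit.QuantumFields.BalabanUV.Beta.CombChartJointEndReflTablesAn1S2N (d1Drift_JsB12CombShSym_an1TablesS2_pinned_of_locks_hcomp_D1Tel_D1Rep)
open Literature.MathematicalPhysics.QuantumFieldTheory.Balaban1983to89.Beta.VectorTailsLoc (fam kfam)
open Literature.MathematicalPhysics.QuantumFieldTheory.Balaban1983to89.Beta.VectorLegVolumeAdapter (MvE)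
open OneStepResolventKernel (JetData)
open OneStepKernelFamily (D1Tel D1Rep D1Drift)
open Summit.QuantumFields.BalabanUV.Beta.CombLevelZeroT2Law (combR2An1_zero_eq_zero)
open Summit.QuantumFields.BalabanUV.Beta.CombRemainderParityAll (sandwichDefect_eq_zero sandwichDefect_diagK_eq_zero trK_bhKStepSh_all)
open Summit.QuantumFields.BalabanUV.Beta.CombSecondOrderRemainderAn1Scaled (combΔOfAtW combR2An1W combΔAn1W hR2succ_combW)
open Summit.QuantumFields.BalabanUV.Beta.CombSecondOrderDeltaSepScaled (combΔOfAtW_eq_sharp locStencil₂_combR2An1W hΔL_pinnedW)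
open Summit.QuantumFields.BalabanUV.Beta.CombRemainderTadpoleSlotScaled (tadpole_mixOfK_smul_symRMrAn1_eq_zero hRm0W_of_hR2tad)
open Summit.QuantumFields.BalabanUV.Beta.CombLevelZeroT2LawScaled (combR2An1W_zero_eq_zero)
open Summit.QuantumFields.BalabanUV.Beta.SymTablesAn1S2Weighted (symTablesAn1S2w)
open Summit.QuantumFields.BalabanUV.Beta.CombChartJointEndReflTablesAn1S2NScaled (d1Drift_JsB12CombShSym_an1TablesS2w_pinned_of_locks_hcomp_D1Tel_D1Rep)

namespace Summit.QuantumFields.BalabanUV.Beta.CombRemainderParityAllScaled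

variable {Lc : ℕ} [NeZero Lc]

/-! ## §1 THE INDUCTION for the κ-literal: leaf-03's `combR2An1W` and `combΔAn1W` are ROW-PARITY-ODD at every level (the parent's §3 re-run) -/

/-- [folklore] **THE SPLIT DEFECT IS ROW-PARITY-ODD ONCE THE T2-REMAINDER IS** (the κ-literal, level `j`, at the pin `X2s := 0` and the BASE weight lock, every `w`): by leaf-03's `combΔOfAtW_eq_sharp` the defect is
`[𝕄_j, diagK X♯]` (parity-odd: `SecondOrderStepRemainder.parityOdd_conjV_diagK_of_even` + §2) `+ dM (…) S_j M1_j` at the pin `w·cΛ` (`SpineRecursiveParity.parityOdd_dM` + first-order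
row parities) `+` the two slots (leaf-05's `trK_vertex2OfK_of_rows` ∕ `trK_mixOfK_of_rows`, fed by the hypothesis and by `parityOdd_smul w` of P5-a's `trK_symRMrAn1`). -/
theorem parityOdd_combΔAn1W_of_R2 {cΛ : ℝ} {γ : ℕ → ℝ} (hw : ∀ j, cΛ * wM1 3 Lc j * γ j = -wM2 3 Lc j) (w : ℝ) (N j : ℕ) (α : Fin 4)
    (hR2 : ∀ (κ : Fin 4) (u : Fin 4 → ℤ) (κ' : Fin 4) (u' : Fin 4 → ℤ),
      trK (combR2An1W Lc N cΛ w γ (0 : ℕ → Fin 4 → Fin 4 → (Fin 4 → ℤ) → Fin 4 → (Fin 4 → ℤ) → (Fin 4 → ℤ) → Fib 3 → ℝ) j α κ u κ' u') =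
        -sgnK (combR2An1W Lc N cΛ w γ (0 : ℕ → Fin 4 → Fin 4 → (Fin 4 → ℤ) → Fin 4 → (Fin 4 → ℤ) → (Fin 4 → ℤ) → Fib 3 → ℝ) j α κ u κ' u'))
    (μ : Fin 4) (y : Fin 4 → ℤ) (ν : Fin 4) (y' : Fin 4 → ℤ) :
    trK (combΔAn1W Lc N cΛ w γ (0 : ℕ → Fin 4 → Fin 4 → (Fin 4 → ℤ) → Fin 4 → (Fin 4 → ℤ) → (Fin 4 → ℤ) → Fib 3 → ℝ) j α μ y ν y') =
      -sgnK (combΔAn1W Lc N cΛ w γ (0 : ℕ → Fin 4 → Fin 4 → (Fin 4 → ℤ) → Fin 4 → (Fin 4 → ℤ) → (Fin 4 → ℤ) → Fib 3 → ℝ) j α μ y ν y') := by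
  have hL1 : 1 ≤ Lc := one_le_of_neZero Lc
  have hR2c : ∃ C δ : ℝ, 0 < δ ∧ LocStencil₂ (combR2An1W Lc N cΛ w γ (0 : ℕ → Fin 4 → Fin 4 → (Fin 4 → ℤ) → Fin 4 → (Fin 4 → ℤ) → (Fin 4 → ℤ) → Fib 3 → ℝ) j α) C δ :=
    locStencil₂_combR2An1W (Lc := Lc) N cΛ w γ 0 α (fun j' => sep_zeroTable (Lc := Lc) j' α) j
  have e : combΔAn1W Lc N cΛ w γ (0 : ℕ → Fin 4 → Fin 4 → (Fin 4 → ℤ) → Fin 4 → (Fin 4 → ℤ) → (Fin 4 → ℤ) → Fib 3 → ℝ) j α μ y ν y' =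
      combΔOfAtW Lc N cΛ w γ 0 j (combR2An1W Lc N cΛ w γ 0 j) α μ y ν y' := rfl
  have halg : ∀ (A B C D : MKer 4 (Fib 3)), A + B + C - D = (A - D) + B + C := fun _ _ _ _ => by abel
  rw [e, combΔOfAtW_eq_sharp (Lc := Lc) N cΛ w γ 0 j (Rj := combR2An1W Lc N cΛ w γ 0 j) α hR2c μ y ν y', halg, conjW_sub_conjW, diagK_zeroTable,
    conjV_zero, sub_zero]
  have hS : ∀ (κ : Fin 4) (u : Fin 4 → ℤ), trK (SpureRecOf 3 Lc (symVhSAt (ctr 4 Lc) 3 Lc rfl) (symHessFFAt (ctr 4 Lc) Lc) (GcombSh Lc) ((Lc : ℝ) ^ 4) (-((Lc : ℝ) ^ 8 / 2)) (w * cΛ) j κ u) =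
      -sgnK (SpureRecOf 3 Lc (symVhSAt (ctr 4 Lc) 3 Lc rfl) (symHessFFAt (ctr 4 Lc) Lc) (GcombSh Lc) ((Lc : ℝ) ^ 4) (-((Lc : ℝ) ^ 8 / 2)) (w * cΛ) j κ u) :=
    fun κ u => trK_SpureRecOf (d := 3) (symVhSAt_hV_ctr (d := 3) hL1) (symHessFFAt_hH_ctr (d := 3) hL1) (decays_GcombSh Lc)
      (fun j' => trK_GcombSh (d := 3) (Lc := Lc) j') (fun κ u => trK_symVhSAt _ _ κ u) (fun μ y => trK_symHessFFAt _ _ μ y) _ _ (w * cΛ) j κ u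
  have hM : ∀ (ρ : Fin 4) (t : Fin 4 → ℤ), trK (M1Of 3 Lc (symHessFFAt (ctr 4 Lc) Lc) (w * cΛ) j ρ t) = -sgnK (M1Of 3 Lc (symHessFFAt (ctr 4 Lc) Lc) (w * cΛ) j ρ t) :=
    fun ρ t => trK_M1Of_symHessFFAt (d := 3) _ (w * cΛ) j ρ t
  exact parityOdd_add (parityOdd_add (parityOdd_conjV_diagK_of_even _ (trK_bhKStepSh_all (Lc := Lc) j)) (parityOdd_dM _ _ hS hM μ y))
    (parityOdd_add (trK_vertex2OfK_of_rows _ hR2 μ y ν y')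
      (parityOdd_add (trK_mixOfK_of_rows _ (fun κ u ρ t => parityOdd_smul w (trK_symRMrAn1 (hw j) α κ u ρ t)) μ y ν y')
        (trK_mixOfK_of_rows _ (fun κ u ρ t => parityOdd_smul w (trK_symRMrAn1 (hw j) α κ u ρ t)) ν y' μ y)))

/-- [folklore] **THE (hT2-rem) REMAINDER OF THE κ-LITERAL (leaf-03's `combR2An1W`) IS ROW-PARITY-ODD AT EVERY LEVEL, EVERY `w`** (`Lc` odd, `2 ≤ N`, the pinned `γ_j`, the BASE weight lock):
induction on the level — base `CombLevelZeroT2LawScaled.combR2An1W_zero_eq_zero`; step = leaf-03's `hR2succ_combW` in which the four chart-conjugation SANDWICH-DEFECT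
words VANISH (the parent's §1, κ-free, BY NAME), leaving leaf-05's hereditary shape `−(c • mmRead (G′_j ∘ Rm_j ∘ G′_j)) + 0 + conjV (mmRead G′_j) (diagK …)`
(`SecondOrderStepRemainder.parityOdd_mmRead_sandwich` ∕ `parityOdd_conjV_mmRead_diagK`) with `Rm_j` parity-odd by `parityOdd_combΔAn1W_of_R2`. -/
theorem trK_combR2An1W (hLc : Odd Lc) {N : ℕ} (hN : 2 ≤ N) {cΛ : ℝ} (hw : ∀ j, cΛ * wM1 3 Lc j * (-((Lc : ℝ) ^ 8 / 2) * wVH 3 Lc j / (stepScale 3 Lc j * (Lc : ℝ) ^ 4)) = -wM2 3 Lc j) (w : ℝ) :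
    ∀ (j : ℕ) (α κ : Fin 4) (u : Fin 4 → ℤ) (κ' : Fin 4) (u' : Fin 4 → ℤ),
      trK (combR2An1W Lc N cΛ w (fun j => -((Lc : ℝ) ^ 8 / 2) * wVH 3 Lc j / (stepScale 3 Lc j * (Lc : ℝ) ^ 4)) (0 : ℕ → Fin 4 → Fin 4 → (Fin 4 → ℤ) → Fin 4 → (Fin 4 → ℤ) → (Fin 4 → ℤ) → Fib 3 → ℝ) j α κ u κ' u') =
        -sgnK (combR2An1W Lc N cΛ w (fun j => -((Lc : ℝ) ^ 8 / 2) * wVH 3 Lc j / (stepScale 3 Lc j * (Lc : ℝ) ^ 4)) (0 : ℕ → Fin 4 → Fin 4 → (Fin 4 → ℤ) → Fin 4 → (Fin 4 → ℤ) → (Fin 4 → ℤ) → Fib 3 → ℝ) j α κ u κ' u') := by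
  have hL1 : 1 ≤ Lc := one_le_of_neZero Lc
  intro j
  induction j with
  | zero =>
    intro α κ u κ' u'
    rw [combR2An1W_zero_eq_zero (Lc := Lc) hLc hN cΛ w _ (fun _ => rfl) _]
    exact parityOdd_zero
  | succ j ih =>
    intro α κ u κ' u'
    have hA : Spr (GcombSh (d := 3) Lc j) := spr_GcombSh (d := 3) (Lc := Lc) j
    -- the diagonal dressed contact is localised
    obtain ⟨m, C, Cs, CM, Cg, hm, hC, hG, hS, hM1, hgl⟩ := comb_letters_common (Lc := Lc) (w * cΛ) (fun j => -((Lc : ℝ) ^ 8 / 2) * wVH 3 Lc j / (stepScale 3 Lc j * (Lc : ℝ) ^ 4)) j α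
    have hΞ : ∀ (κ₀ : Fin 4) (u₀ : Fin 4 → ℤ), Loc (diagK fun p c => ∑ ι, ∑' v, colH (GcombSh Lc j) Lc κ₀ u₀ ι v *
        ((fun j => -((Lc : ℝ) ^ 8 / 2) * wVH 3 Lc j / (stepScale 3 Lc j * (Lc : ℝ) ^ 4)) j * ctGenM 3 (bhK Lc + Dsh Lc) α Lc ι v p c)) :=
      fun κ₀ u₀ => loc_diagK_dressed (N := Lc) ⟨m, C, hm, hC, hG⟩ hgl hm κ₀ u₀
    -- the W-remainder at level j: localised and parity-odd
    have hΔ := hΔL_pinnedW (Lc := Lc) N cΛ w (fun j => -((Lc : ℝ) ^ 8 / 2) * wVH 3 Lc j / (stepScale 3 Lc j * (Lc : ℝ) ^ 4))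
    have hRmL : Loc ((1 / 2 : ℝ) • (combΔAn1W Lc N cΛ w (fun j => -((Lc : ℝ) ^ 8 / 2) * wVH 3 Lc j / (stepScale 3 Lc j * (Lc : ℝ) ^ 4)) 0 j α κ u κ' u' +
        combΔAn1W Lc N cΛ w (fun j => -((Lc : ℝ) ^ 8 / 2) * wVH 3 Lc j / (stepScale 3 Lc j * (Lc : ℝ) ^ 4)) 0 j α κ' u' κ u)) :=
      ((hΔ j α κ u κ' u').add (hΔ j α κ' u' κ u)).smul _
    have hRmP : trK ((1 / 2 : ℝ) • (combΔAn1W Lc N cΛ w (fun j => -((Lc : ℝ) ^ 8 / 2) * wVH 3 Lc j / (stepScale 3 Lc j * (Lc : ℝ) ^ 4)) 0 j α κ u κ' u' +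
        combΔAn1W Lc N cΛ w (fun j => -((Lc : ℝ) ^ 8 / 2) * wVH 3 Lc j / (stepScale 3 Lc j * (Lc : ℝ) ^ 4)) 0 j α κ' u' κ u)) =
        -sgnK ((1 / 2 : ℝ) • (combΔAn1W Lc N cΛ w (fun j => -((Lc : ℝ) ^ 8 / 2) * wVH 3 Lc j / (stepScale 3 Lc j * (Lc : ℝ) ^ 4)) 0 j α κ u κ' u' +
        combΔAn1W Lc N cΛ w (fun j => -((Lc : ℝ) ^ 8 / 2) * wVH 3 Lc j / (stepScale 3 Lc j * (Lc : ℝ) ^ 4)) 0 j α κ' u' κ u)) :=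
      parityOdd_smul _ (parityOdd_add (parityOdd_combΔAn1W_of_R2 (Lc := Lc) hw w N j α (ih α) κ u κ' u') (parityOdd_combΔAn1W_of_R2 (Lc := Lc) hw w N j α (ih α) κ' u' κ u))
    rw [hR2succ_combW N cΛ w _ 0 j α κ u κ' u', sandwichDefect_diagK_eq_zero j (hΞ κ u), sandwichDefect_diagK_eq_zero j (hΞ κ' u'), comp_zero_left, comp_zero_left,
      comp_zero_right, comp_zero_right, add_zero, add_zero, add_zero, sub_zero, diagK_zeroTable_sub, conjV_zero, smul_zero, zero_add,
      show (0 : ℕ → Fin 4 → Fin 4 → (Fin 4 → ℤ) → Fin 4 → (Fin 4 → ℤ) → MKer 4 (Fib 3)) (j + 1) α κ u κ' u' = 0 from rfl, add_zero]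
    exact parityOdd_add (parityOdd_neg (parityOdd_smul _ (parityOdd_mmRead_sandwich Lc hA (trK_GcombSh (d := 3) (Lc := Lc) j) hRmL hRmP)))
      (parityOdd_conjV_mmRead_diagK Lc _ (trK_GcombSh (d := 3) (Lc := Lc) j))

/-! ## §2 `hR2tad` AT EVERY LEVEL, and the κ-literal's `hRm0` — DISCHARGED -/

/-- [folklore] **THE T2-REMAINDER SLOT IDENTITY `hR2tad` HOLDS AT EVERY LEVEL** (leaf-05's `SecondOrderRemainderTables.tadpole_vertex2OfK_eq_zero`: spread
sgn-symmetric `G′_j`, the `LocStencil₂` class leaf-03's `CombSecondOrderDeltaSepScaled.locStencil₂_combR2An1W` at the pin, row parity §1), for the κ-literal, every `w`. -/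
theorem hR2tadW_all (hLc : Odd Lc) {N : ℕ} (hN : 2 ≤ N) (w : ℝ) {cΛ : ℝ} (hΛ : cΛ * (Lc : ℝ) ^ 4 = 2) :
    ∀ (j : ℕ) (α μ : Fin 4) (y : Fin 4 → ℤ) (ν : Fin 4) (y' : Fin 4 → ℤ),
      tadpole (GcombSh Lc j) (vertex2OfK (GcombSh (d := 3) Lc j) Lc
          (combR2An1W Lc N cΛ w (fun j => -((Lc : ℝ) ^ 8 / 2) * wVH 3 Lc j / (stepScale 3 Lc j * (Lc : ℝ) ^ 4)) (0 : ℕ → Fin 4 → Fin 4 → (Fin 4 → ℤ) → Fin 4 → (Fin 4 → ℤ) → (Fin 4 → ℤ) → Fib 3 → ℝ) j α) μ y ν y') +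
        tadpole (GcombSh Lc j) (vertex2OfK (GcombSh (d := 3) Lc j) Lc
          (combR2An1W Lc N cΛ w (fun j => -((Lc : ℝ) ^ 8 / 2) * wVH 3 Lc j / (stepScale 3 Lc j * (Lc : ℝ) ^ 4)) (0 : ℕ → Fin 4 → Fin 4 → (Fin 4 → ℤ) → Fin 4 → (Fin 4 → ℤ) → (Fin 4 → ℤ) → Fib 3 → ℝ) j α) ν y' μ y) = 0 := by
  intro j α μ y ν y'
  obtain ⟨δ, C, hδ, hC, hG⟩ := decays_GcombSh (d := 3) Lc j
  obtain ⟨C₂, δ₂, hδ₂, hR₂⟩ := locStencil₂_combR2An1W (Lc := Lc) N cΛ w (fun j => -((Lc : ℝ) ^ 8 / 2) * wVH 3 Lc j / (stepScale 3 Lc j * (Lc : ℝ) ^ 4)) 0 α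
    (fun j' => sep_zeroTable (Lc := Lc) j' α) j
  have hm : 0 < min δ δ₂ := lt_min hδ hδ₂
  have hpar := trK_combR2An1W (Lc := Lc) hLc hN (fun j' => lock_of_hΛ (Lc := Lc) hΛ j') w j α
  rw [tadpole_vertex2OfK_eq_zero (spr_GcombSh (d := 3) (Lc := Lc) j) (trK_GcombSh (d := 3) (Lc := Lc) j) (decays_mono hG hC le_rfl (min_le_left _ _)) hC hm
      (hR₂.mono (min_le_right _ _)) hpar μ y ν y',
    tadpole_vertex2OfK_eq_zero (spr_GcombSh (d := 3) (Lc := Lc) j) (trK_GcombSh (d := 3) (Lc := Lc) j) (decays_mono hG hC le_rfl (min_le_left _ _)) hC hm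
      (hR₂.mono (min_le_right _ _)) hpar ν y' μ y, add_zero]

/-- **ROW D1, THE (III″) κ-LITERAL: ITS SCALAR `hRm0` — DISCHARGED, EVERY GROUP WEIGHT `w`.**  For `Lc` odd, `2 ≤ N`, the lock `hΛ : cΛ·Lc⁴ = 2`: for EVERY level `j`, axis `α` and pair of
coarse bonds, `tadpole (GcombSh Lc j) (Rm_j α μ y ν y′) = 0` for the κ-literal's W-remainder — the `hRm0` binder of leaf-04's Nw root VERBATIM (`X2s := 0`, `γ_j` pinned), now a theorem
(P5-a-κ `CombRemainderTadpoleSlotScaled.hRm0W_of_hR2tad` ∘ `hR2tadW_all`).  HONEST: [folklore] kernel algebra over OUR typed objects; ONE displayed binder of the repair-track root is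
PROVED; `D1Tel`, `D1Rep` remain; nothing of Bałaban's asserted; NOT D1. -/
theorem hRm0W_discharged (hLc : Odd Lc) {N : ℕ} (hN : 2 ≤ N) (w : ℝ) {cΛ : ℝ} (hΛ : cΛ * (Lc : ℝ) ^ 4 = 2) :
    ∀ (j : ℕ) (α μ : Fin 4) (y : Fin 4 → ℤ) (ν : Fin 4) (y' : Fin 4 → ℤ),
      tadpole (GcombSh Lc j)
        ((1 / 2 : ℝ) • conjV (bhKStepSh 3 Lc (Dsh Lc) j) (diagK fun p a => (0 : ℕ → Fin 4 → Fin 4 → (Fin 4 → ℤ) → Fin 4 → (Fin 4 → ℤ) → (Fin 4 → ℤ) → Fib 3 → ℝ) j α ν y' μ y p a - (0 : ℕ → Fin 4 → Fin 4 → (Fin 4 → ℤ) → Fin 4 → (Fin 4 → ℤ) → (Fin 4 → ℤ) → Fib 3 → ℝ) j α μ y ν y' p a) +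
          (1 / 2 : ℝ) • (combΔAn1W Lc N cΛ w (fun j => -((Lc : ℝ) ^ 8 / 2) * wVH 3 Lc j / (stepScale 3 Lc j * (Lc : ℝ) ^ 4)) (0 : ℕ → Fin 4 → Fin 4 → (Fin 4 → ℤ) → Fin 4 → (Fin 4 → ℤ) → (Fin 4 → ℤ) → Fib 3 → ℝ) j α μ y ν y' + combΔAn1W Lc N cΛ w (fun j => -((Lc : ℝ) ^ 8 / 2) * wVH 3 Lc j / (stepScale 3 Lc j * (Lc : ℝ) ^ 4)) (0 : ℕ → Fin 4 → Fin 4 → (Fin 4 → ℤ) → Fin 4 → (Fin 4 → ℤ) → (Fin 4 → ℤ) → Fib 3 → ℝ) j α ν y' μ y)) = 0 :=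
  hRm0W_of_hR2tad (Lc := Lc) hΛ w N (hR2tadW_all (Lc := Lc) hLc hN w hΛ)

/-- **ROW D1 — THE (III″) κ-TWIN CHAIN: THE κ-GENERIC ROOT.  `D1Drift (JsB12CombShSym hLc N (symTablesAn1S2w 3 Lc (w·cΛ) w) (w·cΛ) cB) ⟸ hΛ ∧ hcB ∧ D1Tel ∧ D1Rep`,
FOR EVERY GROUP WEIGHT `w : ℝ`** (+ the route theorem's own binders, VERBATIM M‴'s: printed B5 facts `h12`∕`h126`, window, `μ ≠ ν`, `Nc ≠ 0`, `2 ≤ Lc`,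
`Odd Lc`, `2 ≤ N`) — leaf-04 g33's Nw root `CombChartJointEndReflTablesAn1S2NScaled.d1Drift_JsB12CombShSym_an1TablesS2w_pinned_of_locks_hcomp_D1Tel_D1Rep` with its
scalar `hRm0` SUPPLIED by §2 `hRm0W_discharged`, EXACTLY as ROOT M‴ applies ROOT M″.  Binder census vs M‴: ONE added name in the real group
(`(cΛ w cB : ℝ)`), the record `symTablesAn1S2w 3 Lc (w·cΛ) w` and the pin `w·cΛ` in `htel` and in the conclusion; every other binder identical in name,
order and type.  The member `w = 1` IS M‴'s statement (`symTablesAn1S2w_one`, `one_mul`); the member `w = Lc¹²∕4` is the (III″) LITERAL, ACCEPTED BY VALUE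
at level 0 (Engine C `prestab/atk/ATK.md` ea54d781657b45d1, an2 RCPT-4 l.63155, leaf-01 R-2 l.63194) — displayed in `D1LiteralLagrangianRoot`, NOT here.
HONEST: composition by name over OUR typed objects; `D1Tel`, `D1Rep` OPEN (the roads' — FP ∕ BF-x); nothing of Bałaban's asserted, valued or discharged;
ROOT M‴ p325680 and the root of record untouched; NOT D1, NEVER «G-an2-4 closed», NOT `BetaPertH`, NOT continuum, NOT Clay. -/
theorem d1Drift_JsB12CombShSym_an1TablesS2w_pinned_of_locks_D1Tel_D1Rep (hLc : Odd Lc) (hL2 : 2 ≤ Lc) {N : ℕ} (hN : 2 ≤ N) (cΛ w cB : ℝ)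
    -- the two unit locks of an1's TABLE-FIT tier 2
    (hΛ : cΛ * (Lc : ℝ) ^ 4 = 2) (hcB : cB = -((Lc : ℝ) ^ 12 / 4))
    -- the route theorem's own binders, verbatim
    (a : ℝ) (ha : 0 < a)
    (h12 : B5.Prop12Printed (fam (fun i : ℕ+ × ℕ => ((i.1 : ℕ+) : ℕ)) (fun i => i.1.pos) MvE a ha))
    (h126 : B5.Kernel126_127Printed (kfam (fun i : ℕ+ × ℕ => ((i.1 : ℕ+) : ℕ)) MvE))
    {L : Type*} {SL : Finset L} (hSL : SL.Nonempty) (k : L → Fin 4) {μ ν : Fin 4} (hμν : μ ≠ ν) {Nc : ℝ} (hNc : Nc ≠ 0)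
    (Jc : ∀ m : ℕ, JetData 3 (Lc ^ m))
    (htel : D1Tel Lc (JsB12CombShSym hLc N (symTablesAn1S2w 3 Lc (w * cΛ) w) (w * cΛ) cB) Jc)
    {cc : ℝ} {Mw' : ℕ → ℕ} (hc : 1 ≤ cc) (hMwin : ∀ L : ℕ, 2 ≤ L → 1 ≤ Mw' L ∧ (L : ℝ) ≤ cc * Mw' L) (hML : ∀ L : ℕ, 2 ≤ L → Mw' L ≤ L)
    (hrep : D1Rep Lc Jc Nc μ ν a SL k) :
    D1Drift Lc (JsB12CombShSym hLc N (symTablesAn1S2w 3 Lc (w * cΛ) w) (w * cΛ) cB) Nc μ ν :=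
  d1Drift_JsB12CombShSym_an1TablesS2w_pinned_of_locks_hcomp_D1Tel_D1Rep hLc hL2 hN cΛ w cB hΛ hcB (hRm0W_discharged (Lc := Lc) hLc hN w hΛ)
    a ha h12 h126 hSL k hμν hNc Jc htel hc hMwin hML hrep

end Summit.QuantumFields.BalabanUV.Beta.CombRemainderParityAllScaled

end
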